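import Literature.MathematicalPhysics.QuantumFieldTheory.Balaban1983to89.Node00.Record12BgRowCoClassGaugeR
import Literature.MathematicalPhysics.QuantumFieldTheory.Balaban1983to89.Node00.Record12BgRowCoClassCPMFloor
import Literature.MathematicalPhysics.QuantumFieldTheory.Balaban1983to89.Node00.TorusCoverGaugeTokensGuarded

/-!
# NODE 00 — ROW P11, THE GUARD-GENERIC PORT OF THE GAUGE SENTENCE AND OF ITS ROW LEMMAS: [15] THEOREM 1 (9) LINE 1 IN ∃-GAUGE FORM WITH A PREFIX GUARD `Adm ν M g K k s`
# DISPLAYED (module 47's `StepGuard`) — `VariationalThm1GaugeRegSepTop7MG F N Sup M Adm B₃ B₃' a₀ a₁` ∕ `VariationalThm1GaugeRegSepCoP7MG F N M Adm B₃ B₃' a₀ a₁`, the row body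
# keyed on them and on module 49 §4's guarded (8)-sentence, the supplier from module 51's `Gauge9RegSepTopStepG`, the Stage-13 lift — GaugeR §1–§5 ∕ module 50 with `hc ↦ hadm`

Cell `pub-ymgap` (HUMAN RULINGS D-0062 ∕ D-0088), seat `pub-ymgap-dag-n07-e` generation 21 (R141 (C) row s3 lineage; DAG node N07 = [B11]; lane owner; declarer of modules
20 ∕ 29 ∕ 46–52), 2026-08-28.  `--kind definition --supports stmt-QuantumFields-20541` (K0⁷; count-neutral).  Item (t2)∕G of the lane owner's V20 memo (`V20-STUB1-TEXT-PROPOSAL.md`,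
cell bus 2026-08-28 11:11Z), PRE-STAGED ahead of the plan's word so that either reading of stub 1 is registrable the same hour: under the G reading (`∃ c c₀ B₃ a₀ a₁, …
Prop8RegSepTopStepG F 2 suppDom Adm B₃ a₀ a₁` at a CONCRETE guard) the K0 body consumes the (8)-sentence as module 49 §4's `VariationalThm1RegSepCoP7MG … Adm …` and the
(9)-sentence as THIS file's `VariationalThm1GaugeRegSepCoP7MG … M Adm …` (supplied from module 51's `Gauge9RegSepTopStepG` by §4); row P11's body and its Stage-13 lift then read
`hadm : Adm ν M g K k s` where dag-n21-c's R lemmas and module 50 read `hc : c ≤ ν.M₁`.  With `Adm := floorGuard F c` every statement here IS its R twin (§1∕§3 `…_iff_G_floorGuard`,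
`Iff.rfl`).  NEW leaf; `Record12BgRowCoClassGaugeR` (dag-n21-c g11), modules 49 ∕ 50 ∕ 51 CONSUMED BY NAME, nothing edited.  [B11] = [15] = `[Balaban1985Variational]` (CMP 102) Thm 1
(6)–(9) pp. 278–279, Sect. F (144)–(152) pp. 300–301, Prop. 8 p. 304, p. 304 lines 1–2 («R₁M₁ sufficiently big»); [6] = `[Balaban1985RegularSpaces]` (CMP 99) (1.3)–(1.9) p. 77,
Prop. 6 p. 99; [III] = `[Balaban1988Convergent]` (CMP 119) §2; [I] = `[Balaban1987RG1]` (CMP 109) (0.1) p. 251 (the torus `L^{m+K}`: a guard is a predicate on the prefixes of the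
construction), (1.11)–(1.16) p. 262.

CONTENTS (sorry-free; two `def`s = `Prop`s with parameters, NEVER asserted; axioms standard).  §1 ★★ `VariationalThm1GaugeRegSepTop7MG` (def: GaugeR §1's text with
`Adm ν M g K k s →` for `c ≤ ν.M₁ →`, binder order `hsep hM₁ hadm` = module 51's) + `.toG ∕ .of_le ∕ .mono ∕ .of_imp ∕ _top_iff ∕ _iff_G_floorGuard (Iff.rfl) ∕ .toG_of_imp_floor ∕
.toR_of_floor_imp`.  §2 `localGaugeOn_of_thm1GaugeRegSepTop7MG`, ★★★ `bgRowAtDatumU_of_thm1RegSepTop7MG_of_thm1GaugeG` (module 50 §1 with `hadm`; ONE guard for the (8)- and the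
(9)-sentence — consumers holding two guards refine both to their conjunction by `.of_imp`).  §3 ★★ `VariationalThm1GaugeRegSepCoP7MG` (def, `Sup := suppDomOfRecord`) + bookkeeping,
`localGaugeOn_UbgMSCoPOfRecord_of_thm1GaugeRegSepCoP7MG`, ★★★ `bgRowAtDatumCoP_of_thm1RegSepCoP7MG_of_thm1GaugeG`.  §4 ★ `variationalThm1GaugeRegSep{Top7MG,CoP7MG}_of_gauge9TopStepG`
(minimal ⇒ critical), ★ `variationalThm1GaugeRegSepCoP7MG_of_prop8TopStepG_of_gauge152R` (the (9)-half of the G road in one call).  §5 ★ `Stage13Params.bgAtDatumCoP_of_thm1RegSepCoP7MG_of_thm1GaugeG`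
(module 50 §3's lift; the guard enters as an INNER antecedent right after `0 < θ.ν.M₁`, discharged per prefix by the consumer — e.g. a level half from `PartCompat₁₃`).
NOT HERE: the G twins of dag-n21-c's FILE B ∕ k0-s1-w3's V20 composition files (their pens, keyed on §3∕§5 by name), the V20 texts (plan), any CONCRETE guard.
HONEST SCOPE.  Hypothesis threading around NAMED FACTS (`Prop`s with parameters, NEVER asserted) + bookkeeping; nothing of [B11] ∕ [6] ∕ [III] asserted or discharged;
`stub_prop8StepCoP13` ∕ K0⁷ NOT closed; N07 NOT discharged; counts unmoved (typed 28∕28 · discharged 5∕27); one finite `𝕋⁴` family at fixed `ε` — the route closes the conditional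
finite-𝕋⁴ rung `BalabanLadder.UV` only; NOT continuum ∕ ℝ⁴ ∕ OS ∕ mass gap ∕ Clay.  Two `def`s, no `instance`, no `notation`, no `sorry`.
-/

noncomputable section

open MeasureTheory
open scoped Matrix.Norms.L2Operator
namespace Literature.MathematicalPhysics.QuantumFieldTheory.Balaban1983to89.Node00

open T4Continuum B14.Eq218Concrete B15DeterminingSets B12RegularSpaces111 B14RegularSpaces234 B14Radii T4AxialGaugeSmallField

/-! ## §1  The gauge sentence with a prefix guard displayed — top-domain form -/

section NamedFactGaugeTopMG

variable (F : T4Family) (N : ℕ) [NeZero N]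

/-- **★★ NAMED FACT, GUARD-GENERIC PORT — [15] THEOREM 1 (9) LINE 1, ∃-GAUGE FORM, OVER PRINT'S CLASS (6) ON THE SUPPORT `Ω₀ = Sup ν K s.Ω`, AT NUMERICS WITH `M₁ ≥ 1` AND AT THE
PREFIXES `(ν, M, g, K, k, {Ω_j})` PASSING THE GUARD `Adm`, CUBE LETTER `M`** (a `Prop` with parameters, NEVER asserted): dag-n21-c's `VariationalThm1GaugeRegSepTop7MR F N Sup M c …`
(GaugeR §1) VERBATIM with the hypothesis `c ≤ ν.M₁` replaced by `Adm ν M g K k s` (module 47's `StepGuard`; slot and binder order = module 51's `Gauge9RegSepTopStepG`).  The K0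
skeleton names a CONCRETE guard (never a free `Adm`); print's guard is «of the construction» ([I] (0.1)) with p. 304 lines 1–2.  HONEST LABEL and named absorptions: as GaugeR §1.
-- TODO(general form): as GaugeR §1 (Hölder member and (10) not part of this sentence; ONE threshold ε₁ in print; general admissible `{Ω_j}`; print's `R ≥ R₁`, `M` a multiple of `R₁M₁`).
[cite: Balaban1985Variational, (1) p.277, Thm 1 (2),(3),(5),(6),(7),(9) pp.278–279, (144)–(152) pp.300–301, p.304 lines 1–2; Balaban1985RegularSpaces, (1.3)–(1.9) p.77, Prop. 6 p.99; Balaban1988Convergent, (2.6)–(2.8) pp.255–256, (2.12)–(2.13) p.256, (2.27)–(2.28) p.259, (2.38) p.261; Balaban1987RG1, (0.1) p.251, (1.12) p.262] -/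
def VariationalThm1GaugeRegSepTop7MG (Sup : (ν : Stage7Numerics) → (K : ℕ) → (ℕ → Set (Site (F.P K) 0)) → Set (Site (F.P K) 0)) (M : ℕ) (Adm : StepGuard F)
    (B₃ B₃' a₀ a₁ : ℝ) : Prop :=
  ∀ (ν : Stage7Numerics) (g : ℕ → ℝ) (K k : ℕ) (s : SeqOfRecord F ν M g K k), Sect2.SeqSeparated ν.M₁ s → 0 < ν.M₁ → Adm ν M g K k s → ∀ (ε₀ : ℝ) (δ : ℕ → ℝ),
    (∀ n, n ≤ k → 0 < δ n ∧ δ n ≤ a₁ ∧ B₃ * δ n ≤ ε₀) → (∀ n, n < k → δ n ≤ 2 * δ (n + 1)) → (∀ n, n < k → δ (n + 1) ≤ 2 * δ n) → ε₀ ≤ a₀ →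
    ∀ W : MSField (F.P K) (SU N), Sect2.DataSmall7PTop (avOfRecord F N K) s.Ω (Sup ν K s.Ω) k δ W →
      ∀ U₀, IsMinimizer (avOfRecord F N K)
          {U | (∀ n, n ≤ k → PlaqSmallOn (Sect2.omegaPlaqsTop s.Ω (Sup ν K s.Ω) n) (ε₀ * (F.P K).eta n ^ 2) U) ∧
            Sect2.CoDivClassOnTop s.Ω (Sup ν K s.Ω) k ε₀ U} (genSet s.Ω k) W U₀ →
        ∀ n, 1 ≤ n → n ≤ k →
          (((B14.Eq213MaximalDomains.side (F.P K).L M n : ℕ) : ℤ) < (F.P K).sitesPerDir 0 →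
            ∀ a ∈ cubeIndices (F.P K) (B14.Eq213MaximalDomains.side (F.P K).L M n),
              cubeEnl (F.P K) (B14.Eq213MaximalDomains.side (F.P K).L M n) a 0 ⊆ s.Ω n →
              Sect2.LocalGaugeOn (cubeEnl (F.P K) (B14.Eq213MaximalDomains.side (F.P K).L M n) a 0) ((F.P K).eta n) (B₃' * δ n) U₀) ∧
          (((B14.Eq213MaximalDomains.side (F.P K).L M (n + 1) : ℕ) : ℤ) < (F.P K).sitesPerDir 0 →
            ∀ a ∈ cubeIndices (F.P K) (B14.Eq213MaximalDomains.side (F.P K).L M (n + 1)),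
              cubeEnl (F.P K) (B14.Eq213MaximalDomains.side (F.P K).L M (n + 1)) a 0 ⊆ s.Ω n →
              Sect2.LocalGaugeOn (cubeEnl (F.P K) (B14.Eq213MaximalDomains.side (F.P K).L M (n + 1)) a 0) ((F.P K).eta n) (B₃' * δ n) U₀)

variable {F N}

/-- FLOOR-FREE ⇒ GUARDED, every guard: node00-def-P11's `VariationalThm1GaugeRegSepTop7M` implies the guarded sentence. [cite: Balaban1985Variational, Thm 1 (9) p.279 (bookkeeping)] -/
theorem VariationalThm1GaugeRegSepTop7M.toG {Sup : (ν : Stage7Numerics) → (K : ℕ) → (ℕ → Set (Site (F.P K) 0)) → Set (Site (F.P K) 0)} {M : ℕ} {B₃ B₃' a₀ a₁ : ℝ}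
    (h : VariationalThm1GaugeRegSepTop7M F N Sup M B₃ B₃' a₀ a₁) (Adm : StepGuard F) : VariationalThm1GaugeRegSepTop7MG F N Sup M Adm B₃ B₃' a₀ a₁ :=
  fun ν g K k s hsep hM₁ _ => h ν g K k s hsep hM₁

/-- The guarded gauge sentence is ANTITONE in `a₀`, `a₁`. [cite: Balaban1985Variational, Thm 1 p.279 (the range «ε₀ ≤ a₀», «ε₁ ≤ a₁»)] -/
theorem VariationalThm1GaugeRegSepTop7MG.of_le {Sup : (ν : Stage7Numerics) → (K : ℕ) → (ℕ → Set (Site (F.P K) 0)) → Set (Site (F.P K) 0)} {M : ℕ} {Adm : StepGuard F}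
    {B₃ B₃' a₀ a₀' a₁ a₁' : ℝ} (h : VariationalThm1GaugeRegSepTop7MG F N Sup M Adm B₃ B₃' a₀ a₁) (ha₀ : a₀' ≤ a₀) (ha₁ : a₁' ≤ a₁) :
    VariationalThm1GaugeRegSepTop7MG F N Sup M Adm B₃ B₃' a₀' a₁' :=
  fun ν g K k s hsep hM₁ hadm ε₀ δ hnum hcomp hcomp' hε W h7 U₀ hmin =>
    h ν g K k s hsep hM₁ hadm ε₀ δ (fun n hn => ⟨(hnum n hn).1, (hnum n hn).2.1.trans ha₁, (hnum n hn).2.2⟩) hcomp hcomp' (hε.trans ha₀) W h7 U₀ hmin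

/-- The guarded gauge sentence is MONOTONE in the gauge constant `B₃'`. [cite: Balaban1985Variational, Thm 1 (9) p.279 (bookkeeping)] -/
theorem VariationalThm1GaugeRegSepTop7MG.mono {Sup : (ν : Stage7Numerics) → (K : ℕ) → (ℕ → Set (Site (F.P K) 0)) → Set (Site (F.P K) 0)} {M : ℕ} {Adm : StepGuard F}
    {B₃ B₃' B₃'' a₀ a₁ : ℝ} (h : VariationalThm1GaugeRegSepTop7MG F N Sup M Adm B₃ B₃' a₀ a₁) (hB : B₃' ≤ B₃'') :
    VariationalThm1GaugeRegSepTop7MG F N Sup M Adm B₃ B₃'' a₀ a₁ := by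
  intro ν g K k s hsep hM₁ hadm ε₀ δ hnum hcomp hcomp' hε W h7 U₀ hmin n hn1 hnk
  have hδ : B₃' * δ n ≤ B₃'' * δ n := mul_le_mul_of_nonneg_right hB (hnum n hnk).1.le
  obtain ⟨hMS, hI⟩ := h ν g K k s hsep hM₁ hadm ε₀ δ hnum hcomp hcomp' hε W h7 U₀ hmin n hn1 hnk
  exact ⟨fun hsN a ha hΩ => (hMS hsN a ha hΩ).of_le hδ, fun hsN a ha hΩ => (hI hsN a ha hΩ).of_le hδ⟩

/-- ANTITONE IN THE GUARD: a stronger guard asks the sentence of fewer prefixes. [cite: Balaban1985Variational, Thm 1 (9) p.279; Balaban1987RG1, (0.1) p.251 (bookkeeping)] -/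
theorem VariationalThm1GaugeRegSepTop7MG.of_imp {Sup : (ν : Stage7Numerics) → (K : ℕ) → (ℕ → Set (Site (F.P K) 0)) → Set (Site (F.P K) 0)} {M : ℕ} {Adm Adm' : StepGuard F}
    {B₃ B₃' a₀ a₁ : ℝ} (h : VariationalThm1GaugeRegSepTop7MG F N Sup M Adm B₃ B₃' a₀ a₁) (himp : ∀ ν M g K k s, Adm' ν M g K k s → Adm ν M g K k s) :
    VariationalThm1GaugeRegSepTop7MG F N Sup M Adm' B₃ B₃' a₀ a₁ :=
  fun ν g K k s hsep hM₁ hadm' => h ν g K k s hsep hM₁ (himp ν M g K k s hadm')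

/-- With the trivial guard the guarded gauge sentence IS node00-def-P11's floor-free one. [cite: Balaban1985Variational, Thm 1 (9) p.279 (bookkeeping)] -/
theorem variationalThm1GaugeRegSepTop7MG_top_iff {Sup : (ν : Stage7Numerics) → (K : ℕ) → (ℕ → Set (Site (F.P K) 0)) → Set (Site (F.P K) 0)} {M : ℕ} {B₃ B₃' a₀ a₁ : ℝ} :
    VariationalThm1GaugeRegSepTop7MG F N Sup M (fun _ _ _ _ _ _ => True) B₃ B₃' a₀ a₁ ↔ VariationalThm1GaugeRegSepTop7M F N Sup M B₃ B₃' a₀ a₁ :=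
  ⟨fun h ν g K k s hsep hM₁ => h ν g K k s hsep hM₁ trivial, fun h => h.toG _⟩

/-- dag-n21-c's R edition IS the instance `Adm := floorGuard F c`. [cite: Balaban1985RegularSpaces, (1.3)–(1.6) p.77; Balaban1985Variational, p.304 lines 1–2 (bookkeeping)] -/
theorem variationalThm1GaugeRegSepTop7MR_iff_G_floorGuard {Sup : (ν : Stage7Numerics) → (K : ℕ) → (ℕ → Set (Site (F.P K) 0)) → Set (Site (F.P K) 0)} {M c : ℕ}
    {B₃ B₃' a₀ a₁ : ℝ} :
    VariationalThm1GaugeRegSepTop7MR F N Sup M c B₃ B₃' a₀ a₁ ↔ VariationalThm1GaugeRegSepTop7MG F N Sup M (floorGuard F c) B₃ B₃' a₀ a₁ :=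
  Iff.rfl

/-- A floor-carrying R gauge sentence serves EVERY guard implying its floor. [cite: Balaban1985RegularSpaces, (1.3)–(1.6) p.77; Balaban1985Variational, p.304 lines 1–2 (bookkeeping)] -/
theorem VariationalThm1GaugeRegSepTop7MR.toG_of_imp_floor {Sup : (ν : Stage7Numerics) → (K : ℕ) → (ℕ → Set (Site (F.P K) 0)) → Set (Site (F.P K) 0)} {M c : ℕ}
    {Adm : StepGuard F} {B₃ B₃' a₀ a₁ : ℝ} (h : VariationalThm1GaugeRegSepTop7MR F N Sup M c B₃ B₃' a₀ a₁) (himp : ∀ ν M g K k s, Adm ν M g K k s → c ≤ ν.M₁) :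
    VariationalThm1GaugeRegSepTop7MG F N Sup M Adm B₃ B₃' a₀ a₁ :=
  (variationalThm1GaugeRegSepTop7MR_iff_G_floorGuard.1 h).of_imp himp

/-- Conversely a guarded sentence whose guard FOLLOWS from a floor gives the R sentence at that floor. [cite: Balaban1985RegularSpaces, (1.3)–(1.6) p.77 (bookkeeping)] -/
theorem VariationalThm1GaugeRegSepTop7MG.toR_of_floor_imp {Sup : (ν : Stage7Numerics) → (K : ℕ) → (ℕ → Set (Site (F.P K) 0)) → Set (Site (F.P K) 0)} {M c : ℕ}
    {Adm : StepGuard F} {B₃ B₃' a₀ a₁ : ℝ} (h : VariationalThm1GaugeRegSepTop7MG F N Sup M Adm B₃ B₃' a₀ a₁) (himp : ∀ ν M g K k s, c ≤ ν.M₁ → Adm ν M g K k s) :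
    VariationalThm1GaugeRegSepTop7MR F N Sup M c B₃ B₃' a₀ a₁ :=
  variationalThm1GaugeRegSepTop7MR_iff_G_floorGuard.2 (h.of_imp himp)

end NamedFactGaugeTopMG

/-! ## §2  ROW P11's body keyed on the guarded (8)- and (9)-sentences (GaugeR §2 ∕ module 50 §1 with `hadm` for `hc`) -/

section RowBodyGaugeG

variable {F : T4Family} {N : ℕ} [NeZero N]

/-- **★ EVERY MINIMISER OVER THE TOP-DOMAIN CLASS (6) AT A PREFIX PASSING THE GUARD CARRIES THE LOCAL GAUGES OF (9) LINE 1 AT THRESHOLD `B₃'·cR·ε_n` ON BOTH CUBE FAMILIES INSIDE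
`Ω_n`, `1 ≤ n ≤ k`** — GaugeR's `localGaugeOn_of_thm1GaugeRegSepTop7MR` with `(hadm : Adm ν M g K k s)` for `(hc : c ≤ ν.M₁)`. [cite: Balaban1985Variational, Thm 1 (2),(6),(7),(9) pp.278–279; Balaban1985RegularSpaces, (1.3) p.77; Balaban1988Convergent, (2.6)–(2.8) pp.255–256, (2.12)–(2.13) p.256, (2.38) p.261; Balaban1987RG1, (0.1) p.251] -/
theorem localGaugeOn_of_thm1GaugeRegSepTop7MG {Sup : (ν : Stage7Numerics) → (K : ℕ) → (ℕ → Set (Site (F.P K) 0)) → Set (Site (F.P K) 0)} {M : ℕ} {Adm : StepGuard F}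
    {B₃ B₃' a₀ a₁ : ℝ} (h15G : VariationalThm1GaugeRegSepTop7MG F N Sup M Adm B₃ B₃' a₀ a₁) (ν : Stage7Numerics)
    (g : ℕ → ℝ) (K k : ℕ) (cR : ℝ) (s : SeqOfRecord F ν M g K k) (hsep : Sect2.SeqSeparated ν.M₁ s) (hM₁ : 0 < ν.M₁) (hadm : Adm ν M g K k s)
    (hnum : ∀ n, n ≤ k → 0 < cR * epsOfRecord ν g n ∧ cR * epsOfRecord ν g n ≤ a₁ ∧ B₃ * (cR * epsOfRecord ν g n) ≤ ν.εreg) (ha₀ : ν.εreg ≤ a₀)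
    (hcomp : ∀ n, n < k → cR * epsOfRecord ν g n ≤ 2 * (cR * epsOfRecord ν g (n + 1)))
    (hcomp' : ∀ n, n < k → cR * epsOfRecord ν g (n + 1) ≤ 2 * (cR * epsOfRecord ν g n))
    {W : MSField (F.P K) (SU N)} (h7 : Sect2.DataSmall7PTop (avOfRecord F N K) s.Ω (Sup ν K s.Ω) k (fun n => cR * epsOfRecord ν g n) W)
    {U₀ : GaugeField (F.P K) 0 (SU N)} (hmin : IsMinimizer (avOfRecord F N K)
      {U | (∀ n, n ≤ k → PlaqSmallOn (Sect2.omegaPlaqsTop s.Ω (Sup ν K s.Ω) n) (ν.εreg * (F.P K).eta n ^ 2) U) ∧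
        Sect2.CoDivClassOnTop s.Ω (Sup ν K s.Ω) k ν.εreg U} (genSet s.Ω k) W U₀) :
    ∀ n, 1 ≤ n → n ≤ k →
      (((B14.Eq213MaximalDomains.side (F.P K).L M n : ℕ) : ℤ) < (F.P K).sitesPerDir 0 →
        ∀ a ∈ cubeIndices (F.P K) (B14.Eq213MaximalDomains.side (F.P K).L M n),
          cubeEnl (F.P K) (B14.Eq213MaximalDomains.side (F.P K).L M n) a 0 ⊆ s.Ω n →
          Sect2.LocalGaugeOn (cubeEnl (F.P K) (B14.Eq213MaximalDomains.side (F.P K).L M n) a 0) ((F.P K).eta n) (B₃' * (cR * epsOfRecord ν g n)) U₀) ∧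
      (((B14.Eq213MaximalDomains.side (F.P K).L M (n + 1) : ℕ) : ℤ) < (F.P K).sitesPerDir 0 →
        ∀ a ∈ cubeIndices (F.P K) (B14.Eq213MaximalDomains.side (F.P K).L M (n + 1)),
          cubeEnl (F.P K) (B14.Eq213MaximalDomains.side (F.P K).L M (n + 1)) a 0 ⊆ s.Ω n →
          Sect2.LocalGaugeOn (cubeEnl (F.P K) (B14.Eq213MaximalDomains.side (F.P K).L M (n + 1)) a 0) ((F.P K).eta n) (B₃' * (cR * epsOfRecord ν g n)) U₀) :=
  h15G ν g K k s hsep hM₁ hadm ν.εreg (fun n => cR * epsOfRecord ν g n) hnum hcomp hcomp' ha₀ W h7 U₀ hmin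

/-- **★★★ ROW P11's BODY AT `(s, 𝐖)` FOR EVERY MINIMISER `U₀` OVER THE TOP-DOMAIN CLASS (6), FROM THE GUARDED (8)-SENTENCE `VariationalThm1RegSepTop7MG … Adm …` (module 49 §4)
AND THE GUARDED GAUGE SENTENCE `VariationalThm1GaugeRegSepTop7MG … M Adm …`, AT A PREFIX PASSING THE GUARD (`hadm : Adm ν M g K k s`)** — module 50 §1 ∕ GaugeR §2's ★★★ with
`hc ↦ hadm` (applications re-sourced to module 49's `plaqSmallOn_of_thm1RegSepTop7MG` and §2's `localGaugeOn_of_thm1GaugeRegSepTop7MG`; closing term node00-def-P11's FILE 14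
`bgRowAtDatumU_of_classBoundsPos_of_localGauge`, byte-identical).  ONE guard serves both sentences: a consumer holding `Adm₈`, `Adm₉` refines both to `Adm₈ ⊓ Adm₉` by `.of_imp`. [cite: Balaban1985Variational, Thm 1 (2),(6)–(9) pp.278–279, p.304 lines 1–2; Balaban1985RegularSpaces, (1.3)–(1.9) p.77; Balaban1988Convergent, (2.4)–(2.8) pp.255–256, (2.12)–(2.13) p.256, (2.27)–(2.28) p.259, (2.34)–(2.41) p.261; Balaban1987RG1, (0.1) p.251, (1.11)–(1.16) p.262] -/
theorem bgRowAtDatumU_of_thm1RegSepTop7MG_of_thm1GaugeG {Sup : (ν : Stage7Numerics) → (K : ℕ) → (ℕ → Set (Site (F.P K) 0)) → Set (Site (F.P K) 0)} {M : ℕ} {Adm : StepGuard F}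
    {B₃ B₃' a₀ a₁ : ℝ} (h15 : VariationalThm1RegSepTop7MG F N Sup Adm B₃ a₀ a₁) (h15G : VariationalThm1GaugeRegSepTop7MG F N Sup M Adm B₃ B₃' a₀ a₁)
    (S : Sect2.Setting (MatA N) (SU N)) (hι : S.ι = ιSU N) (h𝓜 : S.𝓜 = B12RegularSpaces111SpecialUnitary.suModel N) (hS : S.Laws) (hpos : S.Pos)
    (ν : Stage7Numerics) (hM : 0 < M) (K k : ℕ) (cR : ℝ)
    (hnum : ∀ n, n ≤ k → 0 < cR * epsOfRecord ν S.flow.g n ∧ cR * epsOfRecord ν S.flow.g n ≤ a₁ ∧ B₃ * (cR * epsOfRecord ν S.flow.g n) ≤ ν.εreg)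
    (ha₀ : ν.εreg ≤ a₀) (hcomp : ∀ n, n < k → cR * epsOfRecord ν S.flow.g n ≤ 2 * (cR * epsOfRecord ν S.flow.g (n + 1)))
    (hcomp' : ∀ n, n < k → cR * epsOfRecord ν S.flow.g (n + 1) ≤ 2 * (cR * epsOfRecord ν S.flow.g n))
    (hα : ∀ n, 1 ≤ n → n ≤ k → 0 < S.lf.alpha0 (S.flow.g n) ∧ 0 < S.lf.alpha1 (S.flow.g n))
    (hBα : ∀ n, 1 ≤ n → n ≤ k → B₃ * (cR * epsOfRecord ν S.flow.g n) ≤ (1 - S.βc) * S.lf.alpha0 (S.flow.g n))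
    (htI : ∀ n, 1 ≤ n → n ≤ k → B₃' * (cR * epsOfRecord ν S.flow.g n) ≤ S.cB * S.lf.alpha0 (S.flow.g n))
    (htMS : ∀ n, 1 ≤ n → n ≤ k → B₃' * (cR * epsOfRecord ν S.flow.g n) ≤ S.B * S.C * S.Mr * S.lf.alpha0 (S.flow.g n))
    (hC1 : ∀ j, 1 ≤ j → j ≤ k → ∃ t : ℕ, 0 < t ∧ RkOfRecord (F.P K).L ν.r (S.flow.g j) = (F.P K).L * t)
    (hC2 : ∀ j, 1 ≤ j → j ≤ k → dCubeSide (F.P K).L M (RkOfRecord (F.P K).L ν.r (S.flow.g j)) j ∣ (F.P K).sitesPerDir 0)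
    (hsN : ∀ n, 1 ≤ n → n ≤ k + 1 → ((B14.Eq213MaximalDomains.side (F.P K).L M n : ℕ) : ℤ) < (F.P K).sitesPerDir 0)
    (s : SeqOfRecord F ν M S.flow.g K k) (hsep : Sect2.SeqSeparated ν.M₁ s) (hM₁ : 0 < ν.M₁) (hadm : Adm ν M S.flow.g K k s) {W : MSField (F.P K) (SU N)}
    (h7 : Sect2.DataSmall7PTop (avOfRecord F N K) s.Ω (Sup ν K s.Ω) k (fun n => cR * epsOfRecord ν S.flow.g n) W)
    {U₀ : GaugeField (F.P K) 0 (SU N)} (hmin : IsMinimizer (avOfRecord F N K)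
      {U | (∀ n, n ≤ k → PlaqSmallOn (Sect2.omegaPlaqsTop s.Ω (Sup ν K s.Ω) n) (ν.εreg * (F.P K).eta n ^ 2) U) ∧
        Sect2.CoDivClassOnTop s.Ω (Sup ν K s.Ω) k ν.εreg U} (genSet s.Ω k) W U₀) :
    ∀ j, 1 ≤ j → j ≤ k → ∀ X : (Sect2.domSys (F.P K) M j).Dom,
      (Sect2.domSites (F.P K) M j X ⊆ s.Λ j →
        Sect2.ofBackgroundC S.ι (U₀) ∈
          Sect2.spaceI S (Sect2.Residual.unit (F.P K) (MatA N)) M j (Sect2.domSites (F.P K) M j X) (S.lf.alpha0 (S.flow.g j)) (S.lf.alpha1 (S.flow.g j))) ∧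
      (Sect2.admB (F.P K) ν M S.flow.g s.Ω s.Λ j (Sect2.domSites (F.P K) M j X) = true →
        Sect2.ofBackgroundC S.ι (U₀) ∈
          Sect2.spaceMS S (Sect2.Residual.unit (F.P K) (MatA N)) M j (Sect2.domSites (F.P K) M j X) s.Ω) := by
  have hplaq := plaqSmallOn_of_thm1RegSepTop7MG h15 ν M S.flow.g K k cR s hsep hM₁ hadm hnum ha₀ hcomp hcomp' h7 hmin
  have hclass : ∀ n, 1 ≤ n → n ≤ k → PlaqSmallOn (omegaPlaqs s.Ω n) (B₃ * (cR * epsOfRecord ν S.flow.g n) * (F.P K).eta n ^ 2) U₀ := by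
    intro n hn1 hnk
    have := hplaq n hnk
    rwa [Sect2.omegaPlaqsTop_of_ne_zero _ _ (Nat.one_le_iff_ne_zero.mp hn1)] at this
  have hg := localGaugeOn_of_thm1GaugeRegSepTop7MG h15G ν S.flow.g K k cR s hsep hM₁ hadm hnum ha₀ hcomp hcomp' h7 hmin
  exact bgRowAtDatumU_of_classBoundsPos_of_localGauge S hι h𝓜 hS hpos ν hM K k s U₀ hclass hα hBα htI htMS hC1 hC2
    (fun n hn1 hnk => (hg n hn1 hnk).1 (hsN n hn1 (by omega))) (fun n hn1 hnk => (hg n hn1 hnk).2 (hsN (n + 1) (by omega) (by omega)))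

end RowBodyGaugeG

/-! ## §3  The guarded gauge sentence AT THE SUPPORT OF RECORD and the suppliers at node00-def-R's `UbgMSCoPOfRecord … s 𝐖` -/

section AtRecordGaugeCoPMG

variable (F : T4Family) (N : ℕ) [NeZero N]

/-- **★★ NAMED FACT, `CoP` EDITION, GUARD-GENERIC PORT — [15] THEOREM 1 (9) LINE 1 IN ∃-GAUGE FORM OVER CLASS (6) ON THE SUPPORT OF RECORD `suppDomOfRecord`, `M₁ ≥ 1`, PREFIX
GUARD `Adm`, CUBE LETTER `M`**: §1's `VariationalThm1GaugeRegSepTop7MG` at `Sup := suppDomOfRecord` (definitional).  A `Prop` with parameters, NEVER asserted. -- TODO(general form): as §1.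
[cite: Balaban1985Variational, (1) p.277, Thm 1 (2),(3),(5),(6),(7),(9) pp.278–279, (144)–(152) pp.300–301, p.304 lines 1–2; Balaban1985RegularSpaces, (1.3)–(1.9) p.77, Prop. 6 p.99; Balaban1988Convergent, (2.6)–(2.8) pp.255–256, (2.12)–(2.13) p.256, (2.27)–(2.28) p.259, (2.38) p.261; Balaban1987RG1, (0.1) p.251] -/
def VariationalThm1GaugeRegSepCoP7MG (M : ℕ) (Adm : StepGuard F) (B₃ B₃' a₀ a₁ : ℝ) : Prop :=
  VariationalThm1GaugeRegSepTop7MG F N (fun ν K Ω => suppDomOfRecord F ν K Ω) M Adm B₃ B₃' a₀ a₁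

variable {F N}

/-- Definitional bridge to the guarded top-domain sentence at the selector of record. [cite: Balaban1985Variational, Thm 1 (9) p.279 (bookkeeping)] -/
theorem VariationalThm1GaugeRegSepCoP7MG.toTop7MG {M : ℕ} {Adm : StepGuard F} {B₃ B₃' a₀ a₁ : ℝ} (h : VariationalThm1GaugeRegSepCoP7MG F N M Adm B₃ B₃' a₀ a₁) :
    VariationalThm1GaugeRegSepTop7MG F N (fun ν K Ω => suppDomOfRecord F ν K Ω) M Adm B₃ B₃' a₀ a₁ := h

/-- Conversely (definitional). [cite: Balaban1985Variational, Thm 1 (9) p.279 (bookkeeping)] -/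
theorem VariationalThm1GaugeRegSepTop7MG.toCoP7MG {M : ℕ} {Adm : StepGuard F} {B₃ B₃' a₀ a₁ : ℝ}
    (h : VariationalThm1GaugeRegSepTop7MG F N (fun ν K Ω => suppDomOfRecord F ν K Ω) M Adm B₃ B₃' a₀ a₁) : VariationalThm1GaugeRegSepCoP7MG F N M Adm B₃ B₃' a₀ a₁ := h

/-- FLOOR-FREE `CoP` ⇒ guarded `CoP`, every guard. [cite: Balaban1985Variational, Thm 1 (9) p.279 (bookkeeping)] -/
theorem VariationalThm1GaugeRegSepCoP7M.toG {M : ℕ} {B₃ B₃' a₀ a₁ : ℝ} (h : VariationalThm1GaugeRegSepCoP7M F N M B₃ B₃' a₀ a₁) (Adm : StepGuard F) :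
    VariationalThm1GaugeRegSepCoP7MG F N M Adm B₃ B₃' a₀ a₁ :=
  VariationalThm1GaugeRegSepTop7M.toG h Adm

/-- The guarded gauge `CoP` sentence is ANTITONE in `a₀`, `a₁`. [cite: Balaban1985Variational, Thm 1 p.279 (the range «ε₀ ≤ a₀», «ε₁ ≤ a₁»)] -/
theorem VariationalThm1GaugeRegSepCoP7MG.of_le {M : ℕ} {Adm : StepGuard F} {B₃ B₃' a₀ a₀' a₁ a₁' : ℝ} (h : VariationalThm1GaugeRegSepCoP7MG F N M Adm B₃ B₃' a₀ a₁)
    (ha₀ : a₀' ≤ a₀) (ha₁ : a₁' ≤ a₁) : VariationalThm1GaugeRegSepCoP7MG F N M Adm B₃ B₃' a₀' a₁' :=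
  VariationalThm1GaugeRegSepTop7MG.of_le h ha₀ ha₁

/-- The guarded gauge `CoP` sentence is MONOTONE in `B₃'`. [cite: Balaban1985Variational, Thm 1 (9) p.279 (bookkeeping)] -/
theorem VariationalThm1GaugeRegSepCoP7MG.mono {M : ℕ} {Adm : StepGuard F} {B₃ B₃' B₃'' a₀ a₁ : ℝ} (h : VariationalThm1GaugeRegSepCoP7MG F N M Adm B₃ B₃' a₀ a₁)
    (hB : B₃' ≤ B₃'') : VariationalThm1GaugeRegSepCoP7MG F N M Adm B₃ B₃'' a₀ a₁ :=
  VariationalThm1GaugeRegSepTop7MG.mono h hB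

/-- The guarded gauge `CoP` sentence is ANTITONE in the guard. [cite: Balaban1985Variational, Thm 1 (9) p.279; Balaban1987RG1, (0.1) p.251 (bookkeeping)] -/
theorem VariationalThm1GaugeRegSepCoP7MG.of_imp {M : ℕ} {Adm Adm' : StepGuard F} {B₃ B₃' a₀ a₁ : ℝ} (h : VariationalThm1GaugeRegSepCoP7MG F N M Adm B₃ B₃' a₀ a₁)
    (himp : ∀ ν M g K k s, Adm' ν M g K k s → Adm ν M g K k s) : VariationalThm1GaugeRegSepCoP7MG F N M Adm' B₃ B₃' a₀ a₁ :=
  VariationalThm1GaugeRegSepTop7MG.of_imp h himp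

/-- dag-n21-c's R `CoP` edition IS the instance `Adm := floorGuard F c`. [cite: Balaban1985RegularSpaces, (1.3)–(1.6) p.77; Balaban1985Variational, p.304 lines 1–2 (bookkeeping)] -/
theorem variationalThm1GaugeRegSepCoP7MR_iff_G_floorGuard {M c : ℕ} {B₃ B₃' a₀ a₁ : ℝ} :
    VariationalThm1GaugeRegSepCoP7MR F N M c B₃ B₃' a₀ a₁ ↔ VariationalThm1GaugeRegSepCoP7MG F N M (floorGuard F c) B₃ B₃' a₀ a₁ :=
  Iff.rfl

/-- A floor-carrying R gauge `CoP` sentence serves every guard implying its floor. [cite: Balaban1985RegularSpaces, (1.3)–(1.6) p.77 (bookkeeping)] -/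
theorem VariationalThm1GaugeRegSepCoP7MR.toG_of_imp_floor {M c : ℕ} {Adm : StepGuard F} {B₃ B₃' a₀ a₁ : ℝ} (h : VariationalThm1GaugeRegSepCoP7MR F N M c B₃ B₃' a₀ a₁)
    (himp : ∀ ν M g K k s, Adm ν M g K k s → c ≤ ν.M₁) : VariationalThm1GaugeRegSepCoP7MG F N M Adm B₃ B₃' a₀ a₁ :=
  (variationalThm1GaugeRegSepCoP7MR_iff_G_floorGuard.1 h).of_imp himp

/-- Conversely a guarded `CoP` sentence whose guard follows from a floor gives the R `CoP` sentence at that floor. [cite: Balaban1985RegularSpaces, (1.3)–(1.6) p.77 (bookkeeping)] -/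
theorem VariationalThm1GaugeRegSepCoP7MG.toR_of_floor_imp {M c : ℕ} {Adm : StepGuard F} {B₃ B₃' a₀ a₁ : ℝ} (h : VariationalThm1GaugeRegSepCoP7MG F N M Adm B₃ B₃' a₀ a₁)
    (himp : ∀ ν M g K k s, c ≤ ν.M₁ → Adm ν M g K k s) : VariationalThm1GaugeRegSepCoP7MR F N M c B₃ B₃' a₀ a₁ :=
  variationalThm1GaugeRegSepCoP7MR_iff_G_floorGuard.2 (h.of_imp himp)

/-- **★ def-R's COLLAR-CLASS BACKGROUND `UbgMSCoPOfRecord … s 𝐖` CARRIES THE LOCAL GAUGES OF (9) LINE 1 AT THRESHOLD `B₃'·cR·ε_n` ON BOTH CUBE FAMILIES INSIDE `Ω_n`, `1 ≤ n ≤ k`, ON THE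
SOLVABLE SET**, at a prefix passing the guard (`hadm`) — GaugeR §3's `localGaugeOn_UbgMSCoPOfRecord_of_thm1GaugeRegSepCoP7MR` with `hc ↦ hadm`. [cite: Balaban1985Variational, Thm 1 (2),(6),(7),(9) pp.278–279; Balaban1985RegularSpaces, (1.3) p.77; Balaban1988Convergent, (2.6)–(2.8) pp.255–256, (2.12)–(2.13) p.256, (2.38) p.261; Balaban1987RG1, (0.1) p.251] -/
theorem localGaugeOn_UbgMSCoPOfRecord_of_thm1GaugeRegSepCoP7MG {M : ℕ} {Adm : StepGuard F} {B₃ B₃' a₀ a₁ : ℝ} (h15G : VariationalThm1GaugeRegSepCoP7MG F N M Adm B₃ B₃' a₀ a₁)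
    (ν : Stage7Numerics) (g : ℕ → ℝ) (K k : ℕ) (cR : ℝ) (s : SeqOfRecord F ν M g K k) (hsep : Sect2.SeqSeparated ν.M₁ s) (hM₁ : 0 < ν.M₁) (hadm : Adm ν M g K k s)
    (hnum : ∀ n, n ≤ k → 0 < cR * epsOfRecord ν g n ∧ cR * epsOfRecord ν g n ≤ a₁ ∧ B₃ * (cR * epsOfRecord ν g n) ≤ ν.εreg) (ha₀ : ν.εreg ≤ a₀)
    (hcomp : ∀ n, n < k → cR * epsOfRecord ν g n ≤ 2 * (cR * epsOfRecord ν g (n + 1)))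
    (hcomp' : ∀ n, n < k → cR * epsOfRecord ν g (n + 1) ≤ 2 * (cR * epsOfRecord ν g n))
    {W : MSField (F.P K) (SU N)} (h7 : Sect2.DataSmall7PTop (avOfRecord F N K) s.Ω (suppDomOfRecord F ν K s.Ω) k (fun n => cR * epsOfRecord ν g n) W)
    (hsol : W ∈ solvableDom (avOfRecord F N K) (regMSCoPOfRecord F N ν K k s.Ω) (genSet s.Ω k)) :
    ∀ n, 1 ≤ n → n ≤ k →
      (((B14.Eq213MaximalDomains.side (F.P K).L M n : ℕ) : ℤ) < (F.P K).sitesPerDir 0 →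
        ∀ a ∈ cubeIndices (F.P K) (B14.Eq213MaximalDomains.side (F.P K).L M n),
          cubeEnl (F.P K) (B14.Eq213MaximalDomains.side (F.P K).L M n) a 0 ⊆ s.Ω n →
          Sect2.LocalGaugeOn (cubeEnl (F.P K) (B14.Eq213MaximalDomains.side (F.P K).L M n) a 0) ((F.P K).eta n) (B₃' * (cR * epsOfRecord ν g n))
            (UbgMSCoPOfRecord F N ν M g K k s W)) ∧
      (((B14.Eq213MaximalDomains.side (F.P K).L M (n + 1) : ℕ) : ℤ) < (F.P K).sitesPerDir 0 →
        ∀ a ∈ cubeIndices (F.P K) (B14.Eq213MaximalDomains.side (F.P K).L M (n + 1)),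
          cubeEnl (F.P K) (B14.Eq213MaximalDomains.side (F.P K).L M (n + 1)) a 0 ⊆ s.Ω n →
          Sect2.LocalGaugeOn (cubeEnl (F.P K) (B14.Eq213MaximalDomains.side (F.P K).L M (n + 1)) a 0) ((F.P K).eta n) (B₃' * (cR * epsOfRecord ν g n))
            (UbgMSCoPOfRecord F N ν M g K k s W)) :=
  localGaugeOn_of_thm1GaugeRegSepTop7MG h15G ν g K k cR s hsep hM₁ hadm hnum ha₀ hcomp hcomp' h7 (isMinimizer_UbgMSCoPOfRecord ν M g K k s hsol)

/-- **★★★ ROW P11's BODY AT `(s, 𝐖)` FOR def-R's COLLAR-CLASS MINIMISER `UbgMSCoPOfRecord … s 𝐖`, FROM THE GUARDED (8) `CoP` SENTENCE `VariationalThm1RegSepCoP7MG … Adm …` AND THE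
GUARDED GAUGE `CoP` SENTENCE `VariationalThm1GaugeRegSepCoP7MG … M Adm …`, AT A PREFIX PASSING THE GUARD (`hadm : Adm ν M g K k s`)** — module 50 §2 ∕ GaugeR §3's ★★★ with
`hc ↦ hadm`; on the solvable set §2's ★★★, off it the junk `1` (`bgRowAtDatum_one`).  The shape the G twins of dag-n21-c's FILE B ∕ k0-s1-w3's V20 composition key on. [cite: Balaban1985Variational, Thm 1 (2),(6)–(9) pp.278–279, p.304 lines 1–2; Balaban1988Convergent, (2.6)–(2.8) pp.255–256, (2.12)–(2.13) p.256, (2.27)–(2.28) p.259, (2.34)–(2.41) p.261; Balaban1987RG1, (0.1) p.251, (1.11)–(1.16) p.262] -/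
theorem bgRowAtDatumCoP_of_thm1RegSepCoP7MG_of_thm1GaugeG {M : ℕ} {Adm : StepGuard F} {B₃ B₃' a₀ a₁ : ℝ} (h15 : VariationalThm1RegSepCoP7MG F N Adm B₃ a₀ a₁)
    (h15G : VariationalThm1GaugeRegSepCoP7MG F N M Adm B₃ B₃' a₀ a₁)
    (S : Sect2.Setting (MatA N) (SU N)) (hι : S.ι = ιSU N) (h𝓜 : S.𝓜 = B12RegularSpaces111SpecialUnitary.suModel N) (hS : S.Laws) (hpos : S.Pos)
    (ν : Stage7Numerics) (hM : 0 < M) (K k : ℕ) (cR : ℝ)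
    (hnum : ∀ n, n ≤ k → 0 < cR * epsOfRecord ν S.flow.g n ∧ cR * epsOfRecord ν S.flow.g n ≤ a₁ ∧ B₃ * (cR * epsOfRecord ν S.flow.g n) ≤ ν.εreg)
    (ha₀ : ν.εreg ≤ a₀) (hcomp : ∀ n, n < k → cR * epsOfRecord ν S.flow.g n ≤ 2 * (cR * epsOfRecord ν S.flow.g (n + 1)))
    (hcomp' : ∀ n, n < k → cR * epsOfRecord ν S.flow.g (n + 1) ≤ 2 * (cR * epsOfRecord ν S.flow.g n))
    (hα : ∀ n, 1 ≤ n → n ≤ k → 0 < S.lf.alpha0 (S.flow.g n) ∧ 0 < S.lf.alpha1 (S.flow.g n))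
    (hBα : ∀ n, 1 ≤ n → n ≤ k → B₃ * (cR * epsOfRecord ν S.flow.g n) ≤ (1 - S.βc) * S.lf.alpha0 (S.flow.g n))
    (htI : ∀ n, 1 ≤ n → n ≤ k → B₃' * (cR * epsOfRecord ν S.flow.g n) ≤ S.cB * S.lf.alpha0 (S.flow.g n))
    (htMS : ∀ n, 1 ≤ n → n ≤ k → B₃' * (cR * epsOfRecord ν S.flow.g n) ≤ S.B * S.C * S.Mr * S.lf.alpha0 (S.flow.g n))
    (hC1 : ∀ j, 1 ≤ j → j ≤ k → ∃ t : ℕ, 0 < t ∧ RkOfRecord (F.P K).L ν.r (S.flow.g j) = (F.P K).L * t)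
    (hC2 : ∀ j, 1 ≤ j → j ≤ k → dCubeSide (F.P K).L M (RkOfRecord (F.P K).L ν.r (S.flow.g j)) j ∣ (F.P K).sitesPerDir 0)
    (hsN : ∀ n, 1 ≤ n → n ≤ k + 1 → ((B14.Eq213MaximalDomains.side (F.P K).L M n : ℕ) : ℤ) < (F.P K).sitesPerDir 0)
    (s : SeqOfRecord F ν M S.flow.g K k) (hsep : Sect2.SeqSeparated ν.M₁ s) (hM₁ : 0 < ν.M₁) (hadm : Adm ν M S.flow.g K k s) (W : MSField (F.P K) (SU N))
    (h7 : Sect2.DataSmall7PTop (avOfRecord F N K) s.Ω (suppDomOfRecord F ν K s.Ω) k (fun n => cR * epsOfRecord ν S.flow.g n) W) :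
    ∀ j, 1 ≤ j → j ≤ k → ∀ X : (Sect2.domSys (F.P K) M j).Dom,
      (Sect2.domSites (F.P K) M j X ⊆ s.Λ j →
        Sect2.ofBackgroundC S.ι (UbgMSCoPOfRecord F N ν M S.flow.g K k s W) ∈
          Sect2.spaceI S (Sect2.Residual.unit (F.P K) (MatA N)) M j (Sect2.domSites (F.P K) M j X) (S.lf.alpha0 (S.flow.g j)) (S.lf.alpha1 (S.flow.g j))) ∧
      (Sect2.admB (F.P K) ν M S.flow.g s.Ω s.Λ j (Sect2.domSites (F.P K) M j X) = true →
        Sect2.ofBackgroundC S.ι (UbgMSCoPOfRecord F N ν M S.flow.g K k s W) ∈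
          Sect2.spaceMS S (Sect2.Residual.unit (F.P K) (MatA N)) M j (Sect2.domSites (F.P K) M j X) s.Ω) := by
  by_cases hsol : W ∈ solvableDom (avOfRecord F N K) (regMSCoPOfRecord F N ν K k s.Ω) (genSet s.Ω k)
  · exact bgRowAtDatumU_of_thm1RegSepTop7MG_of_thm1GaugeG h15 h15G S hι h𝓜 hS hpos ν hM K k cR hnum ha₀ hcomp hcomp' hα hBα htI htMS hC1 hC2 hsN s hsep hM₁
      hadm h7 (isMinimizer_UbgMSCoPOfRecord ν M S.flow.g K k s hsol)
  · rw [UbgMSCoPOfRecord_eq_one_of_not_mem ν M S.flow.g K k s hsol]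
    exact bgRowAtDatum_one S hpos ν M K k s hα

end AtRecordGaugeCoPMG

/-! ## §4  The guarded gauge sentence FROM module 51's guarded STEP token `Gauge9RegSepTopStepG` — minimal ⇒ critical -/

section FromStepG

variable {F : T4Family} {N : ℕ} [NeZero N]

/-- **★ THE GUARDED GAUGE TOP-DOMAIN SENTENCE FROM THE GUARDED STEP TOKEN**: module 51's `Gauge9RegSepTopStepG F N Sup M Adm B₃ B₃' a₀ a₁` ([15] Sect. F for (9) line 1 at the
objects of record, for configurations in class (6)-Top CRITICAL on the fibre, `1 ≤ k`, at prefixes passing `Adm`) gives §1's sentence for every MINIMISER — minimal over the open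
class ⇒ critical on the fibre (`isCritOnFibre_of_isMinimizer_classTop`, Fermat).  GaugeR §4's term with `hc ↦ hadm`.
[cite: Balaban1985Variational, Thm 1 (9) p.279, p.299, p.300, Prop. 8 p.304, (152) p.301, (167)–(169) pp.304–305; Balaban1988Convergent, (2.12)–(2.13) p.256; Balaban1987RG1, (0.1) p.251] -/
theorem variationalThm1GaugeRegSepTop7MG_of_gauge9TopStepG {Sup : (ν : Stage7Numerics) → (K : ℕ) → (ℕ → Set (Site (F.P K) 0)) → Set (Site (F.P K) 0)} {M : ℕ}
    {Adm : StepGuard F} {B₃ B₃' a₀ a₁ : ℝ} (h9 : Gauge9RegSepTopStepG F N Sup M Adm B₃ B₃' a₀ a₁) :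
    VariationalThm1GaugeRegSepTop7MG F N Sup M Adm B₃ B₃' a₀ a₁ :=
  fun ν g K k s hsep hM₁ hadm ε₀ δ hδ hcomp hcomp' hε₀ W h7 U₀ hU₀ _ hn1 hnk =>
    ⟨fun hSN a ha hΩ => h9 ν g K k s hsep hM₁ hadm (hn1.trans hnk) ε₀ δ hδ hcomp hcomp' hε₀ W h7 U₀ hU₀.1.1 hU₀.1.2 hU₀.2.1
        (isCritOnFibre_of_isMinimizer_classTop hU₀) _ hn1 hnk _ (Or.inl rfl) hSN a ha hΩ,
     fun hSN a ha hΩ => h9 ν g K k s hsep hM₁ hadm (hn1.trans hnk) ε₀ δ hδ hcomp hcomp' hε₀ W h7 U₀ hU₀.1.1 hU₀.1.2 hU₀.2.1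
        (isCritOnFibre_of_isMinimizer_classTop hU₀) _ hn1 hnk _ (Or.inr rfl) hSN a ha hΩ⟩

/-- **★ THE GUARDED GAUGE `CoP` SENTENCE FROM THE GUARDED STEP TOKEN** at def-R's support selector (definitional). [cite: Balaban1985Variational, Thm 1 (9) p.279, Prop. 8 p.304, (152) p.301; Balaban1987RG1, (0.1) p.251] -/
theorem variationalThm1GaugeRegSepCoP7MG_of_gauge9TopStepG {M : ℕ} {Adm : StepGuard F} {B₃ B₃' a₀ a₁ : ℝ}
    (h9 : Gauge9RegSepTopStepG F N (fun ν K Ω => suppDomOfRecord F ν K Ω) M Adm B₃ B₃' a₀ a₁) : VariationalThm1GaugeRegSepCoP7MG F N M Adm B₃ B₃' a₀ a₁ :=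
  (variationalThm1GaugeRegSepTop7MG_of_gauge9TopStepG h9).toCoP7MG

/-- ★ **THE GUARDED GAUGE `CoP` SENTENCE FROM THE GUARDED STUB-1 FACT AND THE (152) TOKEN AT FLOOR `c`** (the (9)-half of the G road in one call): `Prop8RegSepTopStepG … Adm …`
(module 47) with dag-n07-e's floor-carrying (152)-token `Gauge152OfClassTopStepR … M c …` (module 29-R; [6] Prop. 6 at NODE 00's cube member) gives, by module 51's
`gauge9G_of_prop8TopStepG_of_gauge152R` and this §4, the (9) `CoP` sentence under the guard `Adm ⊓ floorGuard c` with gauge constant `B₉·B₃`.  (The (8)-half under the same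
guard is module 49 §4 ∕ the Summits bridge `…N07Thm1Top7FromProp8Guarded`, refined by `.of_imp`.)
[cite: Balaban1985Variational, Thm 1 (8)–(9) p.279, Sect. F pp.300–305, Prop. 8 p.304, (152) p.301, p.304 lines 1–2; Balaban1985RegularSpaces, Prop. 6 p.99; Balaban1987RG1, (0.1) p.251] -/
theorem variationalThm1GaugeRegSepCoP7MG_of_prop8TopStepG_of_gauge152R {M c : ℕ} {Adm : StepGuard F} {B₃ B₉ a₀ a₀' a₁ : ℝ}
    (h8 : Prop8RegSepTopStepG F N (fun ν K Ω => suppDomOfRecord F ν K Ω) Adm B₃ a₀ a₁)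
    (h152 : Gauge152OfClassTopStepR F N (fun ν K Ω => suppDomOfRecord F ν K Ω) M c B₉ a₀') (hB₃ : 0 < B₃) (ha : B₃ * a₁ ≤ a₀') :
    VariationalThm1GaugeRegSepCoP7MG F N M (fun ν M g K k s => Adm ν M g K k s ∧ c ≤ ν.M₁) B₃ (B₉ * B₃) a₀ a₁ :=
  variationalThm1GaugeRegSepCoP7MG_of_gauge9TopStepG (gauge9G_of_prop8TopStepG_of_gauge152R h8 h152 hB₃ ha)

end FromStepG

/-! ## §5  The Stage-13 lift with the guard as an inner antecedent (module 50 §3's twin) -/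

section LiftGaugeG

variable {F : T4Family} {N : ℕ} [NeZero N]

/-- **★ ROW P11's BODY AT `UbgMSCoPOfRecord … n s 𝐖` AT THE STAGE-13 RECORD FROM THE GUARDED (8) `VariationalThm1RegSepCoP7MG … Adm …` AND THE GUARDED GAUGE `CoP` SENTENCE AT
CUBE LETTER `θ.τ9.M`, AT EVERY PREFIX `(p, n, s)` PASSING THE GUARD** — module 50 §3's `Stage13Params.bgAtDatumCoP_of_thm1RegSepCoP7MR_of_thm1GaugeR` with the outer floor
hypothesis `hc : c ≤ θ.ν.M₁` replaced by the INNER antecedent `Adm θ.ν θ.τ9.M (gOfRecord₁₃ F N θ p) p.K n s` right after `0 < θ.ν.M₁` (discharged per prefix by a consumer with a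
concrete guard); every other letter as there (laws ∕ `Pos` ∕ radii from admissibility, (C2) = `PartCompat₁₃`).  A REDUCTION — the two sentences are hypotheses, never asserted.
[cite: Balaban1985Variational, (6)–(7) p.278, Thm 1 (8)–(9) p.279, (152) p.301, Prop. 8 p.304, p.304 lines 1–2; Balaban1985RegularSpaces, (1.3)–(1.9) p.77, Prop. 6 p.99; Balaban1988Convergent, Thm 1 p.262, (2.4)–(2.8) pp.255–256, (2.12)–(2.13) p.256, (2.27)–(2.28) p.259, (2.34)–(2.41) p.261; Balaban1987RG1, (0.1) p.251, (1.11)–(1.12) p.262] -/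
theorem Stage13Params.bgAtDatumCoP_of_thm1RegSepCoP7MG_of_thm1GaugeG (θ : Stage13Params F N) (hθ : θ.Admissible F N) (hRz : θ.Rz = RzOfRecord F N)
    {Adm : StepGuard F} {B₃ B₃' a₀ a₁ : ℝ} (hM : 0 < θ.τ9.M)
    (h15 : VariationalThm1RegSepCoP7MG F N Adm B₃ a₀ a₁) (h15G : VariationalThm1GaugeRegSepCoP7MG F N θ.τ9.M Adm B₃ B₃' a₀ a₁)
    (hnum : ∀ (p : B12.RunParams) (n : ℕ), n ≤ p.K → Step.InInterval θ.γ n (gOfRecord₁₃ F N θ p) → ∀ m, m ≤ n →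
      0 < θ.s2.cR * epsOfRecord θ.ν (gOfRecord₁₃ F N θ p) m ∧ θ.s2.cR * epsOfRecord θ.ν (gOfRecord₁₃ F N θ p) m ≤ a₁ ∧ B₃ * (θ.s2.cR * epsOfRecord θ.ν (gOfRecord₁₃ F N θ p) m) ≤ θ.ν.εreg)
    (ha₀ : θ.ν.εreg ≤ a₀)
    (hcomp : ∀ (p : B12.RunParams) (n : ℕ), n ≤ p.K → Step.InInterval θ.γ n (gOfRecord₁₃ F N θ p) → ∀ m, m < n →
      θ.s2.cR * epsOfRecord θ.ν (gOfRecord₁₃ F N θ p) m ≤ 2 * (θ.s2.cR * epsOfRecord θ.ν (gOfRecord₁₃ F N θ p) (m + 1)))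
    (hcomp' : ∀ (p : B12.RunParams) (n : ℕ), n ≤ p.K → Step.InInterval θ.γ n (gOfRecord₁₃ F N θ p) → ∀ m, m < n →
      θ.s2.cR * epsOfRecord θ.ν (gOfRecord₁₃ F N θ p) (m + 1) ≤ 2 * (θ.s2.cR * epsOfRecord θ.ν (gOfRecord₁₃ F N θ p) m))
    (hBα : ∀ (p : B12.RunParams) (n : ℕ), n ≤ p.K → Step.InInterval θ.γ n (gOfRecord₁₃ F N θ p) → ∀ m, 1 ≤ m → m ≤ n →
      B₃ * (θ.s2.cR * epsOfRecord θ.ν (gOfRecord₁₃ F N θ p) m) ≤ (1 - θ.s2.βc) * (lfOfRecord₁₂ F N θ.toStage12Params).alpha0 (gOfRecord₁₃ F N θ p m))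
    (htI : ∀ (p : B12.RunParams) (n : ℕ), n ≤ p.K → Step.InInterval θ.γ n (gOfRecord₁₃ F N θ p) → ∀ m, 1 ≤ m → m ≤ n →
      B₃' * (θ.s2.cR * epsOfRecord θ.ν (gOfRecord₁₃ F N θ p) m) ≤ θ.s2.cB * (lfOfRecord₁₂ F N θ.toStage12Params).alpha0 (gOfRecord₁₃ F N θ p m))
    (htMS : ∀ (p : B12.RunParams) (n : ℕ), n ≤ p.K → Step.InInterval θ.γ n (gOfRecord₁₃ F N θ p) → ∀ m, 1 ≤ m → m ≤ n →
      B₃' * (θ.s2.cR * epsOfRecord θ.ν (gOfRecord₁₃ F N θ p) m) ≤ θ.s2.B * θ.s2.C * θ.s2.Mr * (lfOfRecord₁₂ F N θ.toStage12Params).alpha0 (gOfRecord₁₃ F N θ p m))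
    (hC1 : ∀ (p : B12.RunParams) (n : ℕ), n ≤ p.K → Step.InInterval θ.γ n (gOfRecord₁₃ F N θ p) → ∀ j, 1 ≤ j → j ≤ n →
      ∃ t : ℕ, 0 < t ∧ RkOfRecord (F.P p.K).L θ.ν.r (gOfRecord₁₃ F N θ p j) = (F.P p.K).L * t)
    (hsN : ∀ (p : B12.RunParams) (n : ℕ), n ≤ p.K → ∀ n', 1 ≤ n' → n' ≤ n + 1 →
      ((B14.Eq213MaximalDomains.side (F.P p.K).L θ.τ9.M n' : ℕ) : ℤ) < (F.P p.K).sitesPerDir 0) :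
    ∀ (p : B12.RunParams) (n : ℕ), n ≤ p.K → Step.InInterval θ.γ n (gOfRecord₁₃ F N θ p) → PartCompat₁₃ F N θ p n →
      ∀ s : SeqOfRecord F θ.ν θ.τ9.M (gOfRecord₁₃ F N θ p) p.K n, Sect2.SeqSeparated θ.ν.M₁ s → 0 < θ.ν.M₁ →
      Adm θ.ν θ.τ9.M (gOfRecord₁₃ F N θ p) p.K n s → ∀ W : MSField (F.P p.K) (SU N),
      Sect2.DataSmall7PTop (avOfRecord F N p.K) s.Ω (suppDomOfRecord F θ.ν p.K s.Ω) n (fun j => θ.s2.cR * epsOfRecord θ.ν (gOfRecord₁₃ F N θ p) j) W →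
      ∀ j, 1 ≤ j → j ≤ n → ∀ X : (Sect2.domSys (F.P p.K) θ.τ9.M j).Dom,
      (Sect2.domSites (F.P p.K) θ.τ9.M j X ⊆ s.Λ j →
        Sect2.ofBackgroundC (settingOfRecord₁₃ F N θ p).ι (UbgMSCoPOfRecord F N θ.ν θ.τ9.M (gOfRecord₁₃ F N θ p) p.K n s W) ∈
          Sect2.spaceI (settingOfRecord₁₃ F N θ p) (θ.Rz p.K) θ.τ9.M j (Sect2.domSites (F.P p.K) θ.τ9.M j X)
            ((settingOfRecord₁₃ F N θ p).lf.alpha0 ((settingOfRecord₁₃ F N θ p).flow.g j)) ((settingOfRecord₁₃ F N θ p).lf.alpha1 ((settingOfRecord₁₃ F N θ p).flow.g j))) ∧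
      (Sect2.admB (F.P p.K) θ.ν θ.τ9.M (gOfRecord₁₃ F N θ p) s.Ω s.Λ j (Sect2.domSites (F.P p.K) θ.τ9.M j X) = true →
        Sect2.ofBackgroundC (settingOfRecord₁₃ F N θ p).ι (UbgMSCoPOfRecord F N θ.ν θ.τ9.M (gOfRecord₁₃ F N θ p) p.K n s W) ∈
          Sect2.spaceMS (settingOfRecord₁₃ F N θ p) (θ.Rz p.K) θ.τ9.M j (Sect2.domSites (F.P p.K) θ.τ9.M j X) s.Ω) := by
  intro p n hn hw hpc s hsep hM₁ hadm W h7
  rw [hRz]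
  exact bgRowAtDatumCoP_of_thm1RegSepCoP7MG_of_thm1GaugeG h15 h15G (settingOfRecord₁₃ F N θ p) rfl rfl (settingOfRecord₁₃_laws F N θ p)
    (settingOfRecord₁₃_pos F N θ hθ.1.pos p) θ.ν hM p.K n θ.s2.cR (hnum p n hn hw) ha₀ (hcomp p n hn hw) (hcomp' p n hn hw)
    (fun m _ hm => alphaPos₁₃_of_inInterval hθ hw hm) (hBα p n hn hw) (htI p n hn hw) (htMS p n hn hw) (hC1 p n hn hw) hpc (hsN p n hn) s hsep hM₁ hadm W h7

end LiftGaugeG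

end Literature.MathematicalPhysics.QuantumFieldTheory.Balaban1983to89.Node00

end
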